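import Summits.QuantumFields.BalabanUV.Beta.GAN24.StripAliasWeights
import Summits.QuantumFields.BalabanUV.Beta.GAN24.ArrowAnchorZeroMomenta
import Summits.QuantumFields.BalabanUV.Beta.GAN24.AliasReindex

/-!
# `BalabanUV.Beta.GAN24.FineReadoutAlias` — binder row G-an2-4 / (CONV-C), S-slot located remainder «E3Shape», route «S3-fibre²»
# (gan24-p1 `SKELETON-S3.md` v0.3 §8, RATIFIED method of record for S3-L1∕(S3-1) = «(U2′) explicit-alias», node E3A2 of
# `HOME/b2b-balaban-gan24-formalise-leaf-16/g8/E3A-READOUT.md` §3): THE PER-ALIAS STRIP BOUND OF THE BORDER-FED BLOCK SOLUTION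

NOT IN PRINT; OUR PROOF ATTEMPT (of the road; THIS file is [folklore] bookkeeping over road P1's landed alias currency: leaf-02's explicit
block solution `FibreBlockSolve.Asol`, the strip symbol bounds of `StripAliasBounds` (F2) and the strip weight bounds of `StripAliasWeights`
BY NAME; elementary inequalities only).  HONEST FRAMING (cell contract, verbatim): «discharging `BetaPertH` makes Bałaban's UV stability
UNCONDITIONAL — a real constructive-QFT result; it is NOT the continuum limit and NOT the Clay problem.»  HONEST DEPENDENCY (verbatim):
«continuum YM on T⁴ ⇐ BetaPertH ∧ nine spine estimates (0/9 proved); BetaPertH ⇐ (D1) ∧ (D4) ∧ CAP+tail; G-an2-4 gates asym, D1 and NE2/3/4.»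
No cited fact, no wall binder, no `def … : Prop`; discharges NOTHING of (hS, hSall) / «E3Shape»; NOT `BetaPertH`, NOT continuum, NOT Clay.

## What is proved (generic `D`, block side `N ≥ 1`, alias `m : TorusSite D N`, `m ≠ 0`; strip `|Re p_i| ≤ π`, `|Im p_i| ≤ η`, `0 ≤ η ≤ 1/(6D+8)`)
* §1 `norm_Asol_le` — ABSTRACT: for block data with `‖∂_κ‖, ‖∂♭_κ‖ ≤ a` and `0 < Λ₀ ≤ ‖L‖`,
  `‖Asol ∂ ∂♭ g L cc κ‖ ≤ (‖g κ‖ + a²(Σ_l ‖g l‖)/Λ₀)/(2Λ₀) + ‖cc‖·a/Λ₀²`.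
* §2 THE GOOD-ALIAS STRIP FACTS (m ≠ 0), `Λ := lapR (kfine N (Re p) m)`: `half_lapR_le_norm_LAl` (`Λ/2 ≤ ‖L_m(p)‖`), `norm_dAl_le_two_sqrt`,
  `norm_dbAl_le_two_sqrt` (`≤ 2√Λ`), `four_fold_sq_le` (`4·fold_i² ≤ N²Λ` for `m_i ≠ 0`, leaf-17's `four_mul_fold_sq_le_sq_mul_lapR` BY NAME).
* §3 `norm_Asol_border_le_lapR` — the border-fed block solution (feed `g_l = χ̂_m s♭_l(m) φ_l`, gauge feed `χ̂_m c`, `‖φ_l‖ ≤ Φ`, `‖c‖ ≤ Cc`):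
  `‖Asol …κ‖ ≤ ‖χ̂_m‖ · (√6·N·Φ·(1 + 8D)/Λ + 8·Cc/Λ^{3/2})`.
* §4 (companion module `GAN24/FineReadoutAliasFold`, same namespace) IN THE FOLDED-COORDINATE CURRENCY (`fold_i = min(val, N − val) = |srep m i|`, `F = max_i fold_i ≥ 1`): `norm_chiAl_le_prod` (`‖χ̂_m‖ ≤ (2√3)^D Π_{m_i≠0} fold_i⁻¹`),
  and **`norm_Asol_border_le`**: `‖Asol …κ‖ ≤ K_D · N³ · (Φ·F⁻² + Cc·F⁻³) · Π_{i: m_i ≠ 0} fold_i⁻¹`, `K_D = (2√3)^D · 2·(1 + 8D)` — the summand of leaf-16's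
  `AliasPointSum.pointWeight` at `α = −1` (transverse, weight `Φ`) and `α = −2` (pure gauge, weight `Cc`), times `N³`; with the scaled ℓ² border bounds
  `Φ, Cc = O(A·N^{−(D+4)})` of (U1)+A this is the `N^{−(D+1)}` of the design note §2(c).
Unit `b2b-balaban-gan24-formalise-leaf-16` (G-an2-4 formalisation swarm, leaf prover 16, gen 8; records — idle-seat engine), 2026-08-20.
-/

noncomputable section

open Complex Finset
open scoped BigOperators Real
open Literature.Probability.LatticeModels (TorusSite)
open Literature.MathematicalPhysics.QuantumFieldTheory.Balaban1983to89
open B4Strip (reVec)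
open Summit.QuantumFields.BalabanUV.Beta.GAN24.FibreBlockSolve (dot Asol)
open Summit.QuantumFields.BalabanUV.Beta.GAN24.AliasWeights (sinWt sinWt_pos sinWt_le_one kfine wMaj sinWt_kfine_le_wMaj)
open Summit.QuantumFields.BalabanUV.Beta.GAN24.AliasWeightsSum (lapR lapR_nonneg four_mul_fold_sq_le_sq_mul_lapR)
open Summit.QuantumFields.BalabanUV.Beta.GAN24.AliasObjects (chiAl sbAl dAl dbAl LAl)
open Summit.QuantumFields.BalabanUV.Beta.GAN24.StripAliasBounds (norm_dAl_le norm_dbAl_le norm_LAl_sub_lapR_le_mul sq_div_le_lapR sum_sin_sq_eq_lapR_div)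
open Summit.QuantumFields.BalabanUV.Beta.GAN24.StripAliasWeights (norm_chiAl_sq_le_strip norm_sbAl_sq_le_strip)
open Summit.QuantumFields.BalabanUV.Beta.GAN24.ArrowAnchorZeroMomenta (exists_ne_zero_of_ne_zero)

namespace Summit.QuantumFields.BalabanUV.Beta.GAN24.FineReadoutAlias

/-! ## §1 The abstract block-solution bound -/

section Abstract

variable {D : ℕ}

/-- [folklore] `|∂♭·g| ≤ a·Σ_l ‖g_l‖` when every `‖∂♭_l‖ ≤ a`. -/
theorem norm_dot_le {db g : Fin D → ℂ} {a : ℝ} (hdb : ∀ l, ‖db l‖ ≤ a) :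
    ‖dot db g‖ ≤ a * ∑ l, ‖g l‖ := by
  unfold dot
  calc ‖∑ l, db l * g l‖ ≤ ∑ l, ‖db l * g l‖ := norm_sum_le _ _
    _ ≤ ∑ l, a * ‖g l‖ := Finset.sum_le_sum fun l _ => by
        rw [norm_mul]; exact mul_le_mul_of_nonneg_right (hdb l) (norm_nonneg _)
    _ = a * ∑ l, ‖g l‖ := by rw [Finset.mul_sum]

/-- [folklore] **THE ABSTRACT BOUND ON LEAF-02's EXPLICIT BLOCK SOLUTION**: with `‖∂_κ‖, ‖∂♭_κ‖ ≤ a` and `0 < Λ₀ ≤ ‖L‖`,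
`‖Asol ∂ ∂♭ g L cc κ‖ ≤ (‖g κ‖ + a·(a·Σ_l‖g l‖)/Λ₀)/(2Λ₀) + ‖cc‖/Λ₀²·a`. -/
theorem norm_Asol_le {dd db g : Fin D → ℂ} {L cc : ℂ} {a Λ₀ : ℝ} (ha : 0 ≤ a) (hΛ : 0 < Λ₀) (hL : Λ₀ ≤ ‖L‖)
    (hdd : ∀ l, ‖dd l‖ ≤ a) (hdb : ∀ l, ‖db l‖ ≤ a) (κ : Fin D) :
    ‖Asol dd db g L cc κ‖ ≤ (‖g κ‖ + a * (a * ∑ l, ‖g l‖) / Λ₀) / (2 * Λ₀) + ‖cc‖ / Λ₀ ^ 2 * a := by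
  have hL0 : 0 < ‖L‖ := lt_of_lt_of_le hΛ hL
  have hdot := norm_dot_le (g := g) hdb
  have hsum0 : 0 ≤ ∑ l, ‖g l‖ := Finset.sum_nonneg fun l _ => norm_nonneg _
  unfold Asol
  -- first term
  have h1 : ‖(g κ - dd κ * dot db g / L) / (2 * L)‖ ≤ (‖g κ‖ + a * (a * ∑ l, ‖g l‖) / Λ₀) / (2 * Λ₀) := by
    rw [norm_div, norm_mul, Complex.norm_ofNat]
    have hnum : ‖g κ - dd κ * dot db g / L‖ ≤ ‖g κ‖ + a * (a * ∑ l, ‖g l‖) / Λ₀ := by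
      have hprod : ‖dd κ‖ * ‖dot db g‖ ≤ a * (a * ∑ l, ‖g l‖) := mul_le_mul (hdd κ) hdot (norm_nonneg _) ha
      have hnn : 0 ≤ a * (a * ∑ l, ‖g l‖) := mul_nonneg ha (mul_nonneg ha hsum0)
      calc ‖g κ - dd κ * dot db g / L‖ ≤ ‖g κ‖ + ‖dd κ * dot db g / L‖ := norm_sub_le _ _
        _ = ‖g κ‖ + ‖dd κ‖ * ‖dot db g‖ / ‖L‖ := by rw [norm_div, norm_mul]
        _ ≤ ‖g κ‖ + a * (a * ∑ l, ‖g l‖) / ‖L‖ := by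
            have := div_le_div_of_nonneg_right hprod (norm_nonneg L); linarith
        _ ≤ ‖g κ‖ + a * (a * ∑ l, ‖g l‖) / Λ₀ := by
            have := div_le_div_of_nonneg_left hnn hΛ hL; linarith
    have hden : 2 * Λ₀ ≤ 2 * ‖L‖ := by linarith
    calc ‖g κ - dd κ * dot db g / L‖ / (2 * ‖L‖) ≤ (‖g κ‖ + a * (a * ∑ l, ‖g l‖) / Λ₀) / (2 * ‖L‖) :=
          div_le_div_of_nonneg_right hnum (by positivity)
      _ ≤ (‖g κ‖ + a * (a * ∑ l, ‖g l‖) / Λ₀) / (2 * Λ₀) := by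
          apply div_le_div_of_nonneg_left _ (by positivity) hden
          have : 0 ≤ a * (a * ∑ l, ‖g l‖) / Λ₀ := div_nonneg (mul_nonneg ha (mul_nonneg ha hsum0)) hΛ.le
          positivity
  -- second term
  have h2 : ‖cc / L ^ 2 * dd κ‖ ≤ ‖cc‖ / Λ₀ ^ 2 * a := by
    rw [norm_mul, norm_div, norm_pow]
    have hp : Λ₀ ^ 2 ≤ ‖L‖ ^ 2 := pow_le_pow_left₀ hΛ.le hL 2
    calc ‖cc‖ / ‖L‖ ^ 2 * ‖dd κ‖ ≤ ‖cc‖ / Λ₀ ^ 2 * a :=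
          mul_le_mul (div_le_div_of_nonneg_left (norm_nonneg _) (by positivity) hp) (hdd κ) (norm_nonneg _)
            (div_nonneg (norm_nonneg _) (by positivity))
      _ = ‖cc‖ / Λ₀ ^ 2 * a := rfl
  exact (norm_add_le _ _).trans (add_le_add h1 h2)

end Abstract

/-! ## §2 The good-alias strip facts (`m ≠ 0`) -/

section Strip

variable {D N : ℕ} [NeZero N] {p : Fin D → ℂ} {η : ℝ}

/-- [folklore] The real alias Laplacian is POSITIVE on a nonzero class: `4 ≤ N²·lapR`, hence `0 < lapR`. -/
theorem lapR_pos (hre : ∀ i, |(p i).re| ≤ π) {m : TorusSite D N} (hm : m ≠ 0) : 0 < lapR (kfine N (reVec p) m) := by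
  obtain ⟨i, hi⟩ := exists_ne_zero_of_ne_zero hm
  have h4 := four_mul_fold_sq_le_sq_mul_lapR (p := reVec p) (fun i => hre i) m hi
  have hfold : (1 : ℝ) ≤ ((min (m i).val (N - (m i).val) : ℕ) : ℝ) := by
    have hv : 0 < (m i).val := Nat.pos_of_ne_zero fun h => hi ((ZMod.val_eq_zero _).1 h)
    have hlt : (m i).val < N := ZMod.val_lt _
    exact_mod_cast (show 1 ≤ min (m i).val (N - (m i).val) from le_min hv (by omega))
  have hN : (0 : ℝ) < (N : ℝ) ^ 2 := by have := NeZero.ne N; positivity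
  nlinarith [lapR_nonneg (kfine N (reVec p) m)]

/-- [folklore] **`Λ/2 ≤ ‖L_m(p)‖` ON THE STRIP** for a nonzero alias, as soon as `(3D/2 + 2)·η ≤ 1/2` (F2's relative bound `norm_LAl_sub_lapR_le_mul`). -/
theorem half_lapR_le_norm_LAl (hre : ∀ i, |(p i).re| ≤ π) (him : ∀ i, |(p i).im| ≤ η) (hη : 0 ≤ η)
    (hηD : (3 * D / 2 + 2) * η ≤ 1 / 2) {m : TorusSite D N} (hm : m ≠ 0) :
    lapR (kfine N (reVec p) m) / 2 ≤ ‖LAl N p m‖ := by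
  have hη1 : η ≤ 1 := by
    have : (2 : ℝ) * η ≤ (3 * D / 2 + 2) * η := by
      apply mul_le_mul_of_nonneg_right _ hη; have : (0:ℝ) ≤ D := Nat.cast_nonneg D; linarith
    linarith
  set Λ := lapR (kfine N (reVec p) m) with hΛ
  have hΛ0 : 0 ≤ Λ := lapR_nonneg _
  have h := norm_LAl_sub_lapR_le_mul hre him hη hη1 hm
  have hrev : ‖((Λ : ℝ) : ℂ)‖ - ‖LAl N p m - ((Λ : ℝ) : ℂ)‖ ≤ ‖LAl N p m‖ := by
    have := norm_sub_norm_le ((Λ : ℝ) : ℂ) (((Λ : ℝ) : ℂ) - LAl N p m)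
    rw [sub_sub_cancel, norm_sub_rev] at this
    linarith
  rw [Complex.norm_real, Real.norm_eq_abs, abs_of_nonneg hΛ0] at hrev
  have hle : ‖LAl N p m - ((Λ : ℝ) : ℂ)‖ ≤ Λ / 2 := h.trans (by nlinarith)
  linarith

/-- [folklore] `‖∂̂_κ(k_m)‖ ≤ 2√Λ` on the strip for a nonzero alias (`η ≤ 1`): `2|sin(x_κ/2)| ≤ √Λ` and `2η/N ≤ η√Λ`. -/
theorem norm_dAl_le_two_sqrt (hre : ∀ i, |(p i).re| ≤ π) (him : ∀ i, |(p i).im| ≤ η) (hη : 0 ≤ η) (hη1 : η ≤ 1)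
    {m : TorusSite D N} (hm : m ≠ 0) (κ : Fin D) :
    ‖dAl N p m κ‖ ≤ 2 * Real.sqrt (lapR (kfine N (reVec p) m)) := by
  set x := kfine N (reVec p) m with hx
  set Λ := lapR x with hΛ
  have hΛ0 : 0 ≤ Λ := lapR_nonneg _
  have h := norm_dAl_le him hη1 m κ
  -- 2|sin(x_κ/2)| ≤ √Λ
  have hsin : 2 * |Real.sin (x κ / 2)| ≤ Real.sqrt Λ := by
    have hsq : (2 * |Real.sin (x κ / 2)|) ^ 2 ≤ Λ := by
      have hs := sum_sin_sq_eq_lapR_div x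
      have hle : Real.sin (x κ / 2) ^ 2 ≤ ∑ l, Real.sin (x l / 2) ^ 2 :=
        Finset.single_le_sum (f := fun l => Real.sin (x l / 2) ^ 2) (fun l _ => sq_nonneg _) (Finset.mem_univ κ)
      rw [hs] at hle
      nlinarith [sq_abs (Real.sin (x κ / 2))]
    exact Real.le_sqrt_of_sq_le hsq
  -- 2η/N ≤ η√Λ ≤ √Λ
  have hslope : 2 * (η / N) ≤ Real.sqrt Λ := by
    have hsq : (η / N) ^ 2 ≤ η ^ 2 * Λ / 4 := sq_div_le_lapR hre hm η
    have hη2 : η ^ 2 ≤ 1 := pow_le_one₀ hη hη1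
    have h4 : (2 * (η / N)) ^ 2 ≤ Λ := by
      calc (2 * (η / N)) ^ 2 = 4 * (η / N) ^ 2 := by ring
        _ ≤ 4 * (η ^ 2 * Λ / 4) := by linarith
        _ = η ^ 2 * Λ := by ring
        _ ≤ 1 * Λ := mul_le_mul_of_nonneg_right hη2 hΛ0
        _ = Λ := one_mul Λ
    exact Real.le_sqrt_of_sq_le h4
  linarith

/-- [folklore] The flat twin: `‖∂̂♭_κ(k_m)‖ ≤ 2√Λ`. -/
theorem norm_dbAl_le_two_sqrt (hre : ∀ i, |(p i).re| ≤ π) (him : ∀ i, |(p i).im| ≤ η) (hη : 0 ≤ η) (hη1 : η ≤ 1)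
    {m : TorusSite D N} (hm : m ≠ 0) (κ : Fin D) :
    ‖dbAl N p m κ‖ ≤ 2 * Real.sqrt (lapR (kfine N (reVec p) m)) := by
  set x := kfine N (reVec p) m with hx
  set Λ := lapR x with hΛ
  have hΛ0 : 0 ≤ Λ := lapR_nonneg _
  have h := norm_dbAl_le him hη1 m κ
  have hsin : 2 * |Real.sin (x κ / 2)| ≤ Real.sqrt Λ := by
    have hsq : (2 * |Real.sin (x κ / 2)|) ^ 2 ≤ Λ := by
      have hs := sum_sin_sq_eq_lapR_div x
      have hle : Real.sin (x κ / 2) ^ 2 ≤ ∑ l, Real.sin (x l / 2) ^ 2 :=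
        Finset.single_le_sum (f := fun l => Real.sin (x l / 2) ^ 2) (fun l _ => sq_nonneg _) (Finset.mem_univ κ)
      rw [hs] at hle
      nlinarith [sq_abs (Real.sin (x κ / 2))]
    exact Real.le_sqrt_of_sq_le hsq
  have hslope : 2 * (η / N) ≤ Real.sqrt Λ := by
    have hsq : (η / N) ^ 2 ≤ η ^ 2 * Λ / 4 := sq_div_le_lapR hre hm η
    have hη2 : η ^ 2 ≤ 1 := pow_le_one₀ hη hη1
    have h4 : (2 * (η / N)) ^ 2 ≤ Λ := by
      calc (2 * (η / N)) ^ 2 = 4 * (η / N) ^ 2 := by ring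
        _ ≤ 4 * (η ^ 2 * Λ / 4) := by linarith
        _ = η ^ 2 * Λ := by ring
        _ ≤ 1 * Λ := mul_le_mul_of_nonneg_right hη2 hΛ0
        _ = Λ := one_mul Λ
    exact Real.le_sqrt_of_sq_le h4
  linarith

/-- [folklore] `‖s♭_κ(m)‖ ≤ √6·N` on the strip (`StripAliasWeights.norm_sbAl_sq_le_strip` with `sinWt ≤ 1`). -/
theorem norm_sbAl_le (him : ∀ i, |(p i).im| ≤ η) (hη : 0 ≤ η) (hη4 : η ≤ 1 / 4) (m : TorusSite D N) (κ : Fin D) :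
    ‖sbAl N p m κ‖ ≤ Real.sqrt 6 * N := by
  have h := norm_sbAl_sq_le_strip him hη hη4 m κ
  have hN : (0 : ℝ) ≤ N := Nat.cast_nonneg N
  have h6 : ‖sbAl N p m κ‖ ^ 2 ≤ (Real.sqrt 6 * N) ^ 2 := by
    calc ‖sbAl N p m κ‖ ^ 2 ≤ 6 * (N : ℝ) ^ 2 * sinWt N (kfine N (reVec p) m κ) := h
      _ ≤ 6 * (N : ℝ) ^ 2 * 1 := mul_le_mul_of_nonneg_left (sinWt_le_one _ _) (by positivity)
      _ = (Real.sqrt 6 * N) ^ 2 := by rw [mul_pow, Real.sq_sqrt (by norm_num)]; ring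
  exact (pow_le_pow_iff_left₀ (norm_nonneg _) (by positivity) two_ne_zero).1 h6

end Strip

/-! ## §3 The border-fed block solution in the `lapR` currency -/

section Border

variable {D N : ℕ} [NeZero N] {p : Fin D → ℂ} {η : ℝ}

/-- [folklore] **THE BORDER-FED BLOCK SOLUTION ON THE STRIP, `lapR` CURRENCY** (`m ≠ 0`; feed `g_l = χ̂_m·s♭_l(m)·φ_l`, gauge feed `χ̂_m·c`,
`‖φ_l‖ ≤ Φ`, `‖c‖ ≤ Cc`; `0 ≤ η ≤ 1/4` and `(3D/2+2)η ≤ 1/2`):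
`‖Asol …κ‖ ≤ ‖χ̂_m‖ · (√6·N·Φ·(1 + 8D)/Λ + 8·Cc·√Λ/Λ²)`, `Λ = lapR (kfine N (Re p) m) > 0`. -/
theorem norm_Asol_border_le_lapR (hre : ∀ i, |(p i).re| ≤ π) (him : ∀ i, |(p i).im| ≤ η) (hη : 0 ≤ η) (hη4 : η ≤ 1 / 4)
    (hηD : (3 * D / 2 + 2) * η ≤ 1 / 2) {m : TorusSite D N} (hm : m ≠ 0) {φ : Fin D → ℂ} {c : ℂ} {Φ Cc : ℝ}
    (hΦ : ∀ l, ‖φ l‖ ≤ Φ) (hCc : ‖c‖ ≤ Cc) (κ : Fin D) :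
    ‖Asol (dAl N p m) (dbAl N p m) (fun l => chiAl N p m * sbAl N p m l * φ l) (LAl N p m) (chiAl N p m * c) κ‖
      ≤ ‖chiAl N p m‖ * (Real.sqrt 6 * N * Φ * (1 + 8 * D) / lapR (kfine N (reVec p) m)
          + 8 * Cc * Real.sqrt (lapR (kfine N (reVec p) m)) / lapR (kfine N (reVec p) m) ^ 2) := by
  have hη1 : η ≤ 1 := by linarith
  set Λ := lapR (kfine N (reVec p) m) with hΛ
  have hΛpos : 0 < Λ := lapR_pos hre hm
  set χ := ‖chiAl N p m‖ with hχ
  have hχ0 : 0 ≤ χ := norm_nonneg _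
  have hΦ0 : 0 ≤ Φ := (norm_nonneg _).trans (hΦ κ)
  have hCc0 : 0 ≤ Cc := (norm_nonneg _).trans hCc
  have hN : (0 : ℝ) ≤ N := Nat.cast_nonneg N
  set a := 2 * Real.sqrt Λ with ha
  have ha0 : 0 ≤ a := by positivity
  have haa : a * a = 4 * Λ := by rw [ha]; nlinarith [Real.mul_self_sqrt hΛpos.le]
  -- the abstract bound with Λ₀ = Λ/2, a = 2√Λ
  have hA := norm_Asol_le (g := fun l => chiAl N p m * sbAl N p m l * φ l) (cc := chiAl N p m * c) ha0 (half_pos hΛpos)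
    (half_lapR_le_norm_LAl hre him hη hηD hm) (norm_dAl_le_two_sqrt hre him hη hη1 hm) (norm_dbAl_le_two_sqrt hre him hη hη1 hm) κ
  -- the feeds
  have hg : ∀ l, ‖chiAl N p m * sbAl N p m l * φ l‖ ≤ χ * (Real.sqrt 6 * N) * Φ := fun l => by
    rw [norm_mul, norm_mul]
    exact mul_le_mul (mul_le_mul_of_nonneg_left (norm_sbAl_le him hη hη4 m l) hχ0) (hΦ l) (norm_nonneg _) (by positivity)
  have hsum : ∑ l, ‖chiAl N p m * sbAl N p m l * φ l‖ ≤ D * (χ * (Real.sqrt 6 * N) * Φ) := by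
    calc ∑ l, ‖chiAl N p m * sbAl N p m l * φ l‖ ≤ ∑ _l : Fin D, χ * (Real.sqrt 6 * N) * Φ := Finset.sum_le_sum fun l _ => hg l
      _ = D * (χ * (Real.sqrt 6 * N) * Φ) := by rw [Finset.sum_const, Finset.card_univ, Fintype.card_fin, nsmul_eq_mul]
  have hcc : ‖chiAl N p m * c‖ ≤ χ * Cc := by rw [norm_mul]; exact mul_le_mul_of_nonneg_left hCc hχ0
  -- simplify the abstract bound
  have hB : 0 ≤ χ * (Real.sqrt 6 * N) * Φ := by positivity
  have h1 : (‖chiAl N p m * sbAl N p m κ * φ κ‖ + a * (a * ∑ l, ‖chiAl N p m * sbAl N p m l * φ l‖) / (Λ / 2)) / (2 * (Λ / 2))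
      ≤ χ * (Real.sqrt 6 * N * Φ * (1 + 8 * D) / Λ) := by
    have hnum : ‖chiAl N p m * sbAl N p m κ * φ κ‖ + a * (a * ∑ l, ‖chiAl N p m * sbAl N p m l * φ l‖) / (Λ / 2)
        ≤ χ * (Real.sqrt 6 * N) * Φ * (1 + 8 * D) := by
      have hq : a * (a * ∑ l, ‖chiAl N p m * sbAl N p m l * φ l‖) / (Λ / 2) ≤ 8 * (D * (χ * (Real.sqrt 6 * N) * Φ)) := by
        rw [← mul_assoc, haa, div_le_iff₀ (half_pos hΛpos)]
        nlinarith [mul_le_mul_of_nonneg_left hsum (by positivity : (0:ℝ) ≤ 4 * Λ)]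
      have := hg κ
      nlinarith
    rw [show 2 * (Λ / 2) = Λ by ring]
    calc _ ≤ χ * (Real.sqrt 6 * N) * Φ * (1 + 8 * D) / Λ := div_le_div_of_nonneg_right hnum hΛpos.le
      _ = χ * (Real.sqrt 6 * N * Φ * (1 + 8 * D) / Λ) := by ring
  have h2 : ‖chiAl N p m * c‖ / (Λ / 2) ^ 2 * a ≤ χ * (8 * Cc * Real.sqrt Λ / Λ ^ 2) := by
    have hΛ2 : 0 < (Λ / 2) ^ 2 := by positivity
    calc ‖chiAl N p m * c‖ / (Λ / 2) ^ 2 * a ≤ χ * Cc / (Λ / 2) ^ 2 * a :=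
          mul_le_mul_of_nonneg_right (div_le_div_of_nonneg_right hcc hΛ2.le) ha0
      _ = χ * (8 * Cc * Real.sqrt Λ / Λ ^ 2) := by rw [ha]; field_simp; ring
  exact hA.trans (add_le_add h1 h2) |>.trans (le_of_eq (by ring))

end Border

end Summit.QuantumFields.BalabanUV.Beta.GAN24.FineReadoutAlias

end
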